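import Summits.QuantumFields.YangMills.Theorems.SoloBlindOddTorusLogConvex
import Summits.QuantumFields.YangMills.Theorems.SoloBlindStrongCouplingRung
import HarnessLib

/-!
# The time correlator of `YangMills`: log-convexity, monotonicity, endpoint reduction
# (solo-QuantumFields-blind, rung D8, part 4)

`Summit.QuantumFields.YangMills` asks, inside `HasLatticeMassGap r sch Δ`, for the bound
`|latticeConnectedCorr r.ρ (β k) (2S+1) A B n| ≤ C e^{-Δ a_k n}` for all `S ≥ L k` and ALL
`n ≤ S`.  For the diagonal `A = B` of the time-zero spatial algebra (observables of the spatial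
links of one time slice: spatial plaquettes and Wilson loops, smeared glueball fields) parts 1–3
of this rung give, on the statement's own odd tori and for every `β ≥ 0`:

* `latticeConnectedCorr_eq_timeTwoPtSeq` — the dictionary: the statement's correlator is the
  time autocorrelation sequence of the centred torus observable;
* `latticeConnectedCorr_self_logConvex` — `c(n+1)² ≤ c(n) c(n+2)` (`n + 2 ≤ 2S+1`);
* `latticeConnectedCorr_self_symm` — `c(2S+1-n) = c(n)`;
* `latticeConnectedCorr_self_antitone` — `c(k) ≤ c(j)` for `j ≤ k ≤ S`: the correlator is
  NON-INCREASING over exactly the range `n ≤ S` the statement quantifies over;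
* `latticeConnectedCorr_self_le_exp_of_endpoints` — **endpoint reduction**: the statement's
  bound `c(n) ≤ C e^{-μ n}` for ALL `n ≤ S` already follows from the two bounds at `n = 0`
  (the variance) and `n = S` (the antipodal correlator), because a non-negative log-convex
  sequence lies below the geometric interpolation of its endpoint values.

Here `c(n) = latticeConnectedCorr ρ β (2S+1) A.F A.F n`, `A : YMSpecies G` supported on
time-zero spatial links, `S ≥ 1`, any compact `G` and continuous `ρ`; the spatial plaquette fields
`plaquetteObservable ρ' _ i j` (`i, j ≠ 0`) are instances.  None of this is decay: a constant
sequence satisfies everything (and `U(1)` obeys it verbatim); it is the exact reflection-positivity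
structure of the object the statement bounds.

References: K. Osterwalder, E. Seiler, Ann. Phys. 110 (1978) 440, §2; E. Seiler, LNP 159 (1982)
Ch. 2; M. Lüscher, CMP 54 (1977) 283; J. Glimm, A. Jaffe, *Quantum Physics* (1987) §6.1.
[folklore consequences of OS positivity; the summit-native typed statements and the endpoint
reduction are this unit's]
-/

open MeasureTheory
open Literature.MathematicalPhysics.QuantumFieldTheory Literature.MathematicalPhysics.QuantumLattice

noncomputable section

namespace Summit.QuantumFields.YangMills.Theorems.SoloBlind

/-! ### Centring -/

section Centring

variable {d L N : ℕ} [NeZero d] [NeZero L] {G : Type*} [Group G] [TopologicalSpace G]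
  [IsTopologicalGroup G] [CompactSpace G] [MeasurableSpace G] [BorelSpace G]
  (ρ : G →* Matrix (Fin N) (Fin N) ℂ)

/-- Centring the observable shifts the autocorrelation by a constant:
`T_{F-c}(s) = T_F(s) - 2c⟨F⟩ + c²`. [folklore] -/
theorem timeTwoPt_sub_const (hρ : Continuous ρ) (β : ℝ) {F : GaugeConfig d L G → ℝ}
    (hFm : Measurable F) (hFb : ∃ C : ℝ, ∀ U, |F U| ≤ C) (c : ℝ) (s : ZMod L) :
    timeTwoPt ρ β (fun U => F U - c) s =
      timeTwoPt ρ β F s - 2 * c * wilsonExpectation ρ β F + c ^ 2 := by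
  haveI := isProbabilityMeasure_wilsonMeasure (d := d) (L := L) (G := G) ρ hρ β
  obtain ⟨C, hC⟩ := hFb
  have hC0 : 0 ≤ C := le_trans (abs_nonneg _) (hC (fun _ => 1))
  have hτm : Measurable fun U : GaugeConfig d L G =>
      F (torusConfigShift (-(Pi.single (0 : Fin d) s : Site d L)) U) :=
    hFm.comp (torusConfigShift _).measurable
  have iA : Integrable (fun U : GaugeConfig d L G =>
      F U * F (torusConfigShift (-(Pi.single (0 : Fin d) s : Site d L)) U)) (wilsonMeasure ρ β) := by
    refine Integrable.of_bound (hFm.mul hτm).aestronglyMeasurable (C * C) (ae_of_all _ fun U => ?_)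
    rw [Real.norm_eq_abs, abs_mul]
    exact mul_le_mul (hC _) (hC _) (abs_nonneg _) hC0
  have iF : Integrable F (wilsonMeasure ρ β) :=
    Integrable.of_bound hFm.aestronglyMeasurable C (ae_of_all _ fun U => by
      rw [Real.norm_eq_abs]; exact hC U)
  have iB : Integrable (fun U : GaugeConfig d L G =>
      c * F (torusConfigShift (-(Pi.single (0 : Fin d) s : Site d L)) U)) (wilsonMeasure ρ β) :=
    (Integrable.of_bound hτm.aestronglyMeasurable C (ae_of_all _ fun U => by
      rw [Real.norm_eq_abs]; exact hC _)).const_mul c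
  have iC : Integrable (fun U : GaugeConfig d L G => c * F U) (wilsonMeasure ρ β) := iF.const_mul c
  have iD : Integrable (fun _ : GaugeConfig d L G => c ^ 2) (wilsonMeasure ρ β) := integrable_const _
  have iAB : Integrable (fun U : GaugeConfig d L G =>
      F U * F (torusConfigShift (-(Pi.single (0 : Fin d) s : Site d L)) U) -
        c * F (torusConfigShift (-(Pi.single (0 : Fin d) s : Site d L)) U)) (wilsonMeasure ρ β) :=
    iA.sub iB
  have iABC : Integrable (fun U : GaugeConfig d L G =>
      F U * F (torusConfigShift (-(Pi.single (0 : Fin d) s : Site d L)) U) -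
        c * F (torusConfigShift (-(Pi.single (0 : Fin d) s : Site d L)) U) - c * F U)
      (wilsonMeasure ρ β) := iAB.sub iC
  have hexp : (fun U : GaugeConfig d L G =>
      (F U - c) * (F (torusConfigShift (-(Pi.single (0 : Fin d) s : Site d L)) U) - c)) =
      fun U => F U * F (torusConfigShift (-(Pi.single (0 : Fin d) s : Site d L)) U) -
        c * F (torusConfigShift (-(Pi.single (0 : Fin d) s : Site d L)) U) - c * F U + c ^ 2 := by
    funext U; ring
  have hshift : wilsonExpectation ρ β
      (fun U => F (torusConfigShift (-(Pi.single (0 : Fin d) s : Site d L)) U)) =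
      wilsonExpectation ρ β F :=
    wilsonExpectation_comp_torusConfigShift ρ β _ F
  have hconst : ∫ _ : GaugeConfig d L G, c ^ 2 ∂(wilsonMeasure ρ β) = c ^ 2 := by simp
  simp only [timeTwoPt]
  unfold wilsonExpectation at hshift ⊢
  rw [hexp, integral_add iABC iD, integral_sub iAB iC, integral_sub iA iB, integral_const_mul,
    integral_const_mul, hshift, hconst]
  ring

end Centring

/-! ### The summit's correlator -/

section Summit

variable {G : Type} [Group G] [TopologicalSpace G] [IsTopologicalGroup G] [CompactSpace G]
  [MeasurableSpace G] [BorelSpace G]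

/-- **Dictionary.**  The statement's correlator `latticeConnectedCorr ρ β (2S+1) A A n` is the
time autocorrelation sequence, on the odd torus `(ℤ/(2S+1))⁴`, of the CENTRED torus observable
`Ā = A∘lift - ⟨A∘lift⟩`. [this unit's typing of a folklore identity] -/
theorem latticeConnectedCorr_eq_timeTwoPtSeq {N : ℕ} (ρ : G →* Matrix (Fin N) (Fin N) ℂ)
    (hρ : Continuous ρ) (β : ℝ) (S : ℕ) (A : YMSpecies G) (n : ℕ) :
    latticeConnectedCorr ρ β (2 * S + 1) A.F A.F n =
      timeTwoPtSeq ρ β (fun U => toTorusObservable (2 * S + 1) A.F U -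
        wilsonExpectation ρ β (toTorusObservable (2 * S + 1) A.F)) n := by
  rw [latticeConnectedCorr_eq_wilsonExpectation]
  set F : GaugeConfig 4 (2 * S + 1) G → ℝ := toTorusObservable (2 * S + 1) A.F with hF
  have hFm : Measurable F := A.measurable.comp (measurable_torusLift (2 * S + 1))
  have hFb : ∃ C : ℝ, ∀ U, |F U| ≤ C := by
    obtain ⟨C, hC⟩ := A.bounded
    exact ⟨C, fun U => hC _⟩
  have hprod : toTorusObservable (2 * S + 1)
        (fun U => A.F U * A.F (configShift (-Pi.single 0 (n : ℤ)) U)) =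
      fun U => F U * F (torusConfigShift
        (-(Pi.single (0 : Fin 4) ((n : ℤ) : ZMod (2 * S + 1)) : Site 4 (2 * S + 1))) U) := by
    funext U
    have h := congrFun (toTorusObservable_comp_configShift (G := G) (2 * S + 1)
      (-Pi.single (0 : Fin 4) (n : ℤ)) A.F) U
    have hv : Literature.Probability.LatticeModels.Torus.proj (2 * S + 1)
        (-Pi.single (0 : Fin 4) (n : ℤ)) =
          -(Pi.single (0 : Fin 4) ((n : ℤ) : ZMod (2 * S + 1)) : Site 4 (2 * S + 1)) := by
      funext i
      by_cases hi : i = 0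
      · subst hi; simp
      · simp [hi]
    simp only [toTorusObservable, Function.comp_apply, hv] at h
    simp only [toTorusObservable_apply, hF]
    rw [← h]
  rw [hprod, timeTwoPtSeq, timeTwoPt_sub_const ρ hρ β hFm hFb, Int.cast_natCast]
  simp only [timeTwoPt]
  ring

/-- The centred torus observable of a time-zero spatial species is time-zero spatial, bounded
and measurable. -/
theorem centred_toTorusObservable_hyps {N : ℕ} (ρ : G →* Matrix (Fin N) (Fin N) ℂ) (β : ℝ)
    (S : ℕ) (A : YMSpecies G) (hA : ∀ e ∈ A.supp, e.1 0 = 0 ∧ e.2 ≠ 0) :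
    Measurable (fun U => toTorusObservable (2 * S + 1) A.F U -
        wilsonExpectation ρ β (toTorusObservable (2 * S + 1) A.F)) ∧
      (∃ C : ℝ, ∀ U, |toTorusObservable (2 * S + 1) A.F U -
        wilsonExpectation ρ β (toTorusObservable (2 * S + 1) A.F)| ≤ C) ∧
      DependsOn (fun U => toTorusObservable (2 * S + 1) A.F U -
        wilsonExpectation ρ β (toTorusObservable (2 * S + 1) A.F))
        {e : Edge 4 (2 * S + 1) | e.1 0 = 0 ∧ e.2 ≠ 0} := by
  refine ⟨(A.measurable.comp (measurable_torusLift (2 * S + 1))).sub_const _, ?_, ?_⟩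
  · obtain ⟨C, hC⟩ := A.bounded
    refine ⟨C + |wilsonExpectation ρ β (toTorusObservable (2 * S + 1) A.F)|, fun U => ?_⟩
    calc |toTorusObservable (2 * S + 1) A.F U -
            wilsonExpectation ρ β (toTorusObservable (2 * S + 1) A.F)|
        ≤ |toTorusObservable (2 * S + 1) A.F U| +
            |wilsonExpectation ρ β (toTorusObservable (2 * S + 1) A.F)| := abs_sub _ _
      _ ≤ C + |wilsonExpectation ρ β (toTorusObservable (2 * S + 1) A.F)| := by
          gcongr; exact hC _
  · intro U V hUV
    simp only [toTorusObservable_apply, sub_left_inj]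
    apply A.isCylinder
    intro e he
    obtain ⟨he0, he2⟩ := hA e (Finset.mem_coe.mp he)
    simp only [torusLift, Function.comp_apply]
    apply hUV
    refine ⟨?_, he2⟩
    simp [torusEdge, he0]

/-- **Log-convexity of the statement's correlator** on the time-zero spatial diagonal:
`c(n+1)² ≤ c(n) · c(n+2)` for `n + 2 ≤ 2S+1`, `c(n) = latticeConnectedCorr ρ β (2S+1) A A n`
(`S ≥ 1`, `β ≥ 0`, compact `G`, continuous `ρ`, `A` supported on time-zero spatial links).
[folklore consequence of OS positivity] -/
theorem latticeConnectedCorr_self_logConvex {N : ℕ} (ρ : G →* Matrix (Fin N) (Fin N) ℂ)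
    (hρ : Continuous ρ) {β : ℝ} (hβ : 0 ≤ β) {S : ℕ} (hS : 1 ≤ S) (A : YMSpecies G)
    (hA : ∀ e ∈ A.supp, e.1 0 = 0 ∧ e.2 ≠ 0) (n : ℕ) (hn : n + 2 ≤ 2 * S + 1) :
    latticeConnectedCorr ρ β (2 * S + 1) A.F A.F (n + 1) ^ 2 ≤
      latticeConnectedCorr ρ β (2 * S + 1) A.F A.F n *
        latticeConnectedCorr ρ β (2 * S + 1) A.F A.F (n + 2) := by
  obtain ⟨hm, hb, h0⟩ := centred_toTorusObservable_hyps ρ β S A hA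
  simp only [latticeConnectedCorr_eq_timeTwoPtSeq ρ hρ]
  exact timeTwoPtSeq_logConvex ρ ⟨S, rfl⟩ (by omega) hρ hβ hm hb h0 n hn

/-- **Symmetry** `c(2S+1-n) = c(n)` of the statement's correlator (`n ≤ 2S+1`). [folklore] -/
theorem latticeConnectedCorr_self_symm {N : ℕ} (ρ : G →* Matrix (Fin N) (Fin N) ℂ)
    (hρ : Continuous ρ) (β : ℝ) (S : ℕ) (A : YMSpecies G) {n : ℕ} (hn : n ≤ 2 * S + 1) :
    latticeConnectedCorr ρ β (2 * S + 1) A.F A.F (2 * S + 1 - n) =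
      latticeConnectedCorr ρ β (2 * S + 1) A.F A.F n := by
  simp only [latticeConnectedCorr_eq_timeTwoPtSeq ρ hρ]
  exact timeTwoPtSeq_symm ρ β _ hn

/-- **Monotonicity of the statement's correlator**: on the time-zero spatial diagonal
`n ↦ latticeConnectedCorr ρ β (2S+1) A A n` is NON-INCREASING over `0 ≤ n ≤ S` — exactly the
range `HasLatticeMassGap` quantifies over (`S ≥ 1`, `β ≥ 0`, compact `G`, continuous `ρ`).
[folklore consequence of OS positivity] -/
theorem latticeConnectedCorr_self_antitone {N : ℕ} (ρ : G →* Matrix (Fin N) (Fin N) ℂ)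
    (hρ : Continuous ρ) {β : ℝ} (hβ : 0 ≤ β) {S : ℕ} (hS : 1 ≤ S) (A : YMSpecies G)
    (hA : ∀ e ∈ A.supp, e.1 0 = 0 ∧ e.2 ≠ 0) {j k : ℕ} (hjk : j ≤ k) (hk : k ≤ S) :
    latticeConnectedCorr ρ β (2 * S + 1) A.F A.F k ≤
      latticeConnectedCorr ρ β (2 * S + 1) A.F A.F j := by
  obtain ⟨hm, hb, h0⟩ := centred_toTorusObservable_hyps ρ β S A hA
  simp only [latticeConnectedCorr_eq_timeTwoPtSeq ρ hρ]
  exact timeTwoPtSeq_antitone ρ ⟨S, rfl⟩ (by omega) hρ hβ hm hb h0 hjk (by omega)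

/-- **Endpoint reduction of the lattice mass-gap bound** (time-zero spatial diagonal).  If the
variance and the antipodal correlator obey `c(0) ≤ C` and `c(S) ≤ C e^{-μ S}`, then
`c(n) ≤ C e^{-μ n}` for ALL `n ≤ S` — the full range of `HasLatticeMassGap` — because `c` is
non-negative and log-convex (`S ≥ 1`, `β ≥ 0`, compact `G`, continuous `ρ`).
[this unit's; elementary from OS positivity] -/
theorem latticeConnectedCorr_self_le_exp_of_endpoints {N : ℕ}
    (ρ : G →* Matrix (Fin N) (Fin N) ℂ) (hρ : Continuous ρ) {β : ℝ} (hβ : 0 ≤ β) {S : ℕ}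
    (hS : 1 ≤ S) (A : YMSpecies G) (hA : ∀ e ∈ A.supp, e.1 0 = 0 ∧ e.2 ≠ 0) {C μ : ℝ}
    (h0 : latticeConnectedCorr ρ β (2 * S + 1) A.F A.F 0 ≤ C)
    (hS' : latticeConnectedCorr ρ β (2 * S + 1) A.F A.F S ≤ C * Real.exp (-(μ * S)))
    {n : ℕ} (hn : n ≤ S) :
    latticeConnectedCorr ρ β (2 * S + 1) A.F A.F n ≤ C * Real.exp (-(μ * n)) := by
  obtain ⟨hm, hb, hz⟩ := centred_toTorusObservable_hyps ρ β S A hA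
  have hθ : ∀ k : ℕ, Real.exp (-(μ * k)) = Real.exp (-μ) ^ k := fun k => by
    rw [← Real.exp_nat_mul]; ring_nf
  rw [hθ] at hS' ⊢
  simp only [latticeConnectedCorr_eq_timeTwoPtSeq ρ hρ] at h0 hS' ⊢
  exact timeTwoPtSeq_le_geometric ρ ⟨S, rfl⟩ (by omega) hρ hβ hm hb hz (K := S) (by omega)
    (Real.exp_pos _) h0 hS' hn

/-- **Instance: spatial plaquette fields** (`plaquetteObservable ρ' _ i j`, `i, j ≠ 0`): their
time correlator in the statement's sense is non-increasing over `0 ≤ n ≤ S` on every odd torus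
`(ℤ/(2S+1))⁴`, `S ≥ 1`, for every action model `ρ` and `β ≥ 0`. [folklore] -/
theorem latticeConnectedCorr_plaquette_antitone [SecondCountableTopology G] {N M : ℕ}
    (ρ : G →* Matrix (Fin N) (Fin N) ℂ) (hρ : Continuous ρ) (ρ' : G →* Matrix (Fin M) (Fin M) ℂ)
    (hρ' : Continuous ρ') {β : ℝ} (hβ : 0 ≤ β) {S : ℕ} (hS : 1 ≤ S) {i j : Fin 4} (hi : i ≠ 0)
    (hj : j ≠ 0) {a b : ℕ} (hab : a ≤ b) (hbS : b ≤ S) :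
    latticeConnectedCorr ρ β (2 * S + 1) (plaquetteObservable ρ' hρ' i j).F
        (plaquetteObservable ρ' hρ' i j).F b ≤
      latticeConnectedCorr ρ β (2 * S + 1) (plaquetteObservable ρ' hρ' i j).F
        (plaquetteObservable ρ' hρ' i j).F a := by
  refine latticeConnectedCorr_self_antitone ρ hρ hβ hS _ (fun e he => ?_) hab hbS
  change e ∈ originPlaquetteSupport i j at he
  simp only [originPlaquetteSupport, Finset.mem_insert, Finset.mem_singleton] at he
  rcases he with rfl | rfl | rfl | rfl
  · exact ⟨rfl, hi⟩
  · exact ⟨by simp [hi.symm], hj⟩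
  · exact ⟨by simp [hj.symm], hi⟩
  · exact ⟨rfl, hj⟩

end Summit

end Summit.QuantumFields.YangMills.Theorems.SoloBlind

end
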